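import Summits.AtomisticToContinuum.Crystallization.Theorems.AperiodicFrustratedLawGap.Negative.OffAtlasCapCeiling
import Summits.AtomisticToContinuum.Crystallization.Theorems.FrustratedLawDichotomyAtlasReachTransport
import Summits.AtomisticToContinuum.Crystallization.Theorems.FrustratedLawDichotomyPeriodicEnergyCeilingKernel

/-!
# Crux `AperiodicFrustratedLawGap` (stmt-AtomisticToContinuum-27623) · NEGATIVE lane — THE (410) CAP CEILING DOES NOT TRANSFER TO THE TRANSPORTED CAP
# (decomp-a2c, RESIDUAL lens-5 «finite/base range + asymptotic regime + bridge», generation 118; companion of (404′) `…FrustratedLawDichotomyAtlasReachTransport`)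

(410) `…Negative.OffAtlasCapCeiling` floors (404)'s SITEWISE deficit cap: its 177-point rooted `7/10`-hard-core witness `clusterMeasure` has
`rootEnergy ≤ −1.3995`, so `hcap _ isRootedHardCore_cluster` forces `D ≥ L + 1.3995 ≥ 0.613` for every certified floor `L ≤ e⋆` (N2 `floor_add_le_cap`).
(404′) re-reads the cap on the TRANSPORTED energy `rootEnergy μ + net F G μ`.  THIS FILE runs (410)'s own argument against the transported slot with the
simplest admissible kernel of (404′) §4 — the COMPRESSION PULL `compPull (4/5) (11/10) a` (an uncompressed root pulls `a` from every compressed atom within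
`11/10`; jointly measurable, bounded out-flow: door clauses of (325) by name) — and finds that it yields NOTHING:
* §1 kernel-decided shell facts of the (410) witness `W` (one `decide +kernel` each): its 24 innermost vectors (`W24 = W.take 24`, `97 ≤ |v|² ≤ 115`)
  lie within `|v|² ≤ 121` and each has a CONTACT `0 < |v − w|² < 64` (a witness atom at distance `< 4/5`: the first shell is pairwise COMPRESSED —
  24 points at radius `≈ 1` with mutual distances `≥ 7/10` cannot avoid it); every witness vector has `|v|² ≥ 64` (the ROOT is uncompressed);
  `Σ_{v∈W} g(|v|²) ≥ −14/5` (so `rootEnergy(witness) ≥ −7/5`, the matching lower bound to (410)'s `≤ −1.3995`).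
* §2–§3 hence the root of `clusterMeasure` carries the compression mark `Uncompressed (4/5)`, its 24 first-shell atoms do not, and (404′)
  `transportedDeficit_le_of_contacts` books `24·a` of income at the root: ★ `transportedDeficit_cluster_le : e⋆ − rootEnergy − net ≤ E + 7/5 − 24a`
  for every ceiling `e⋆ ≤ E`.
* §4 ★★ `transportedDeficit_cluster_nonpos`: with the tree's ceiling `e⋆ ≤ −0.7175` (`…PeriodicEnergyCeilingKernel.eStar_le`) the witness's TRANSPORTED
  deficit is `≤ 0` for every `a ≥ 3/100` (with the periodised dimer `e⋆ ≤ −1/24` of (404)'s own cone: for `a ≥ 3/50`); so ★★ `witness_capT`: the witness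
  satisfies EVERY transported cap `D ≥ 0`, and ★ `not_capFloor_transfer`: (410)'s implication «cap instance at the witness ⟹ `3/5 ≤ D`» is FALSE for the
  transported cap (`D = 0`).  Quantitatively `net_cluster_ge`: the transport raises the witness's booked energy by `≥ 24a` (`= 0.72` at `a = 3/100`,
  more than its whole sitewise deficit `≤ 0.6825`).
* §5 FENCE `exists_capT_compPull`: the transported slot is INHABITED for this kernel (some finite `D ≥ 0`: (404)'s `D_univ` plus the route-own finite-range
  bound on what a compressed root pays) — consistent, unfloored by the witness, and NOT evaluated here.
HONEST LABELS.  This is a statement about ONE configuration and ONE kernel family: it shows that the obstruction of record against the sitewise dial is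
not an obstruction against the transported dial; it certifies NO transported cap `D_T` (K2 of the g117 memo: a minimisation over all rooted hard-core
configurations of «deficit − income + outgo», kit-sized, not licensed in this workshop) and says nothing about configurations whose root is itself
compressed (there the root PAYS `≤ a` per uncompressed host within `11/10` — the price K2 must absorb).  Nothing here bears on A(η).
Imports: TREE (410) `…Negative.OffAtlasCapCeiling` (witness data `W`, `pt`, `cluster`, `rootEnergy_cluster`; a certificate file under `*/Negative/`,
importable across files by critic r1906), (404′) `…AtlasReachTransport` (hence (404) `Duniv`, (329) pull-kernel algebra, the route-own
`…TransportPriceLocal.exists_outflow_bound_of_finiteRange`), `…PeriodicEnergyCeilingKernel` (`eStar_le`).  2 plain `def`s (`W24`, `shellOK` : Bool) +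
1 `Finset` (`T24`); no instance / notation / option; 0 sorry; `decide +kernel` only (no `native_decide`).
-/

noncomputable section

namespace Summit.AtomisticToContinuum.Crystallization.Theorems.AperiodicFrustratedLawGap.Negative.OffAtlasCapCeilingTransport

open MeasureTheory Metric Set
open scoped ENNReal BigOperators
open Literature.MathematicalPhysics.StatisticalMechanics Literature.Probability.Process
open Summit.AtomisticToContinuum.Crystallization.Theorems.ChargedEnergyGapNegative (E3 eStar)
open Summit.AtomisticToContinuum.Crystallization.Theorems.FrustratedLawDichotomySignedLedger (net)
open Summit.AtomisticToContinuum.Crystallization.Theorems.PricedLinkCensusLocalToGlobalPhaseGap (eStar_le_neg)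
open Summit.AtomisticToContinuum.Crystallization.Theorems.FrustratedLawDichotomyPeriodicEnergyCeilingKernel (eStar_le)
open Summit.AtomisticToContinuum.Crystallization.Theorems.AperiodicFrustratedLawGap.Negative.OffAtlasCapCeiling
  (W W_spec sq3 sub3 pt norm_pt dist_pt pt_injOn cluster clusterMeasure isRootedHardCore_cluster gQ rootEnergy_cluster rootEnergy_cluster_le)
open Summit.AtomisticToContinuum.Crystallization.Theorems.FrustratedLawDichotomyTransportPriceLocal (exists_outflow_bound_of_finiteRange)
open Summit.AtomisticToContinuum.Crystallization.Theorems.FrustratedLawDichotomyAtlasReach (Duniv Duniv_nonneg deficit_le_Duniv)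
open Summit.AtomisticToContinuum.Crystallization.Theorems.FrustratedLawDichotomyPullKernel (pullKernel_le pullKernel_eq_zero_of_lt_norm
  net_zero_pullKernel_of_not_mark net_zero_pullKernel_nonneg_of_mark)
open Summit.AtomisticToContinuum.Crystallization.Theorems.FrustratedLawDichotomyAtlasReachTransport
  (voidShell measurableSet_voidShell Uncompressed uncompressed_hshift uncompressed_zero_iff not_uncompressed_of_contact compPull
    card_mul_le_net_compPull transportedDeficit_le_of_contacts)

/-! ## §1. Kernel-decided facts about the first shell of the (410) witness -/

/-- The first coordination shell of the witness: its 24 innermost vectors (`97 ≤ |v|² ≤ 115`; `W` is sorted by `|v|²`). [new: witness data] -/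
def W24 : List (ℤ × ℤ × ℤ) := W.take 24

/-- Boolean checker: every first-shell vector has `|v|² ≤ 121` and a CONTACT `w ∈ W` with `0 < |w − v|² < 64`; every witness vector has `|v|² ≥ 64`.
[new: bookkeeping] -/
def shellOK : Bool :=
  (W24.all fun t => decide (sq3 t ≤ 121) && W.any fun s => decide (0 < sq3 (sub3 s t)) && decide (sq3 (sub3 s t) < 64))
    && W.all fun t => decide (64 ≤ sq3 t)

/-- The kernel decides the shell facts (24 norms, 24 contacts among `24 × 176` candidates, 176 norms). [new: certificate] -/
theorem shellOK_W : shellOK = true := by decide +kernel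

/-- The first shell has 24 members. [new: certificate] -/
theorem length_W24 : W24.length = 24 := by decide +kernel

/-- The first shell has no repeated vector. [new: certificate] -/
theorem nodup_W24 : W24.Nodup := by decide +kernel

/-- The kernel sums the 176 rational pair energies from below: `Σ_{v∈W} g(|v|²) ≥ −14/5` (value `−2.79914…`). [new: certificate] -/
theorem sum_gQ_ge : -(14 / 5 : ℚ) ≤ (W.map fun t => gQ (sq3 t)).sum := by decide +kernel

/-- The shell facts, unpacked. [new: certificate] -/
theorem shell_spec : (∀ t ∈ W24, sq3 t ≤ 121 ∧ ∃ s ∈ W, 0 < sq3 (sub3 s t) ∧ sq3 (sub3 s t) < 64) ∧ ∀ t ∈ W, 64 ≤ sq3 t := by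
  have h := shellOK_W
  simp only [shellOK, Bool.and_eq_true, List.all_eq_true, List.any_eq_true, decide_eq_true_eq] at h
  exact h

/-- First-shell vectors are witness vectors. [folklore] -/
theorem W24_subset : ∀ t ∈ W24, t ∈ W := fun _ ht => List.mem_of_mem_take ht

/-! ## §2. Metric readings: norms `≤ 11/10`, contacts `< 4/5`, the root's void window `(0, 4/5)` is empty -/

/-- `|t|² ≤ 121 ⟹ ‖t/10‖ ≤ 11/10`. [folklore] -/
theorem norm_pt_le {t : ℤ × ℤ × ℤ} (h : sq3 t ≤ 121) : ‖pt t‖ ≤ 11 / 10 := by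
  rw [norm_pt]
  have h11 : Real.sqrt (sq3 t : ℝ) ≤ Real.sqrt ((11 : ℝ) ^ 2) := Real.sqrt_le_sqrt (by exact_mod_cast h)
  rw [Real.sqrt_sq (by norm_num)] at h11
  linarith

/-- `64 ≤ |t|² ⟹ 4/5 ≤ ‖t/10‖`. [folklore] -/
theorem norm_pt_ge_of {t : ℤ × ℤ × ℤ} (h : 64 ≤ sq3 t) : 4 / 5 ≤ ‖pt t‖ := by
  rw [norm_pt]
  have h8 : Real.sqrt ((8 : ℝ) ^ 2) ≤ Real.sqrt (sq3 t : ℝ) := Real.sqrt_le_sqrt (by exact_mod_cast h)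
  rw [Real.sqrt_sq (by norm_num)] at h8
  linarith

/-- `|s − t|² < 64 ⟹ dist (s/10) (t/10) < 4/5`. [folklore] -/
theorem dist_pt_lt {s t : ℤ × ℤ × ℤ} (h : sq3 (sub3 s t) < 64) : dist (pt s) (pt t) < 4 / 5 := by
  rw [dist_pt]
  have h8 : Real.sqrt (sq3 (sub3 s t) : ℝ) < 8 := (Real.sqrt_lt' (by norm_num)).2 (by exact_mod_cast h)
  linarith

/-- `0 < |s − t|² ⟹ s/10 ≠ t/10`. [folklore] -/
theorem pt_ne_of_pos {s t : ℤ × ℤ × ℤ} (h : 0 < sq3 (sub3 s t)) : pt s ≠ pt t := fun hst => by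
  have hpos : 0 < dist (pt s) (pt t) := by rw [dist_pt]; exact div_pos (Real.sqrt_pos.2 (by exact_mod_cast h)) (by norm_num)
  rw [hst, dist_self] at hpos
  exact lt_irrefl _ hpos

/-- Witness vectors are atoms of the witness configuration. [folklore] -/
theorem clusterMeasure_singleton_ne_zero {t : ℤ × ℤ × ℤ} (ht : t ∈ W) : clusterMeasure {pt t} ≠ 0 := by
  refine (count_restrict_singleton_ne_zero_iff _ _).2 (Finset.mem_coe.2 ?_)
  simp only [cluster, Finset.mem_insert, List.mem_toFinset, List.mem_map]
  exact Or.inr ⟨t, ht, rfl⟩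

/-- ★ The ROOT of the witness is UNCOMPRESSED: no atom in the punctured ball of radius `4/5` (all `|v|² ≥ 64`, indeed `≥ 97`). [new: certificate] -/
theorem clusterMeasure_voidShell : clusterMeasure (voidShell (4 / 5)) = 0 := by
  rw [clusterMeasure, Measure.restrict_apply (measurableSet_voidShell _), Measure.count_eq_zero_iff, Set.eq_empty_iff_forall_notMem]
  rintro x ⟨⟨hxb, hx0⟩, hxc⟩
  simp only [cluster, Finset.coe_insert, Finset.mem_coe, Set.mem_insert_iff, List.mem_toFinset, List.mem_map] at hxc
  rcases hxc with rfl | ⟨t, ht, rfl⟩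
  · exact hx0 (Set.mem_singleton _)
  · have h45 := norm_pt_ge_of (shell_spec.2 t ht)
    rw [mem_ball_zero_iff] at hxb
    linarith

/-- ★ The root carries the compression mark of (404′). [new: certificate] -/
theorem uncompressed_cluster_root : Uncompressed (4 / 5) clusterMeasure 0 :=
  (uncompressed_zero_iff _ _).2 ⟨isRootedHardCore_cluster, clusterMeasure_voidShell⟩

/-! ## §3. The 24 compressed first-shell atoms -/

/-- ★ The first shell of the witness as a finite set of points of `ℝ³`. [new: witness] -/
def T24 : Finset E3 := (W24.map pt).toFinset

/-- It has exactly 24 points. [new: certificate] -/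
theorem card_T24 : T24.card = 24 := by
  have hnd : (W24.map pt).Nodup :=
    nodup_W24.map_on fun s hs t ht h => pt_injOn s (W24_subset s hs) t (W24_subset t ht) h
  rw [T24, List.toFinset_card_of_nodup hnd, List.length_map, length_W24]

/-- ★ Every first-shell point is an atom within `11/10` of the root and is COMPRESSED (a witness atom at distance `< 4/5`): the `hT` binder of (404′)
`card_mul_le_net_compPull` / `transportedDeficit_le_of_contacts`. [new: certificate] -/
theorem T24_spec : ∀ y ∈ T24, clusterMeasure {y} ≠ 0 ∧ ‖y‖ ≤ 11 / 10 ∧ ¬ Uncompressed (4 / 5) clusterMeasure y := by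
  intro y hy
  simp only [T24, List.mem_toFinset, List.mem_map] at hy
  obtain ⟨t, ht, rfl⟩ := hy
  obtain ⟨h121, s, hs, hpos, h64⟩ := shell_spec.1 t ht
  exact ⟨clusterMeasure_singleton_ne_zero (W24_subset t ht), norm_pt_le h121,
    not_uncompressed_of_contact (clusterMeasure_singleton_ne_zero hs) (pt_ne_of_pos hpos) (dist_pt_lt h64)⟩

/-- ★ The compression pull books `≥ 24·a` of income at the witness root. [new: negative] -/
theorem net_cluster_ge {a : ℝ} (ha : 0 ≤ a) : 24 * a ≤ net 0 (compPull (4 / 5) (11 / 10) a) clusterMeasure := by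
  have h := card_mul_le_net_compPull ha isRootedHardCore_cluster uncompressed_cluster_root T24 T24_spec
  rw [card_T24] at h
  have e : ((24 : ℕ) : ℝ) = 24 := by norm_num
  rw [e] at h
  exact h

/-! ## §4. ★★ The transported deficit of the witness is non-positive: the (410) floor does not transfer -/

/-- `rootEnergy(witness) ≥ −7/5` (the exact value is `−1.39957…`). [new: certificate] -/
theorem rootEnergy_cluster_ge : -(7 / 5 : ℝ) ≤ rootEnergy lennardJones clusterMeasure := by
  rw [rootEnergy_cluster]
  have h : (((-(14 / 5)) : ℚ) : ℝ) ≤ ((((W.map fun t => gQ (sq3 t)).sum) : ℚ) : ℝ) := Rat.cast_le.2 sum_gQ_ge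
  have h' : (((-(14 / 5)) : ℚ) : ℝ) = -(14 / 5) := by push_cast; norm_num
  linarith

/-- ★ THE TRANSPORTED DEFICIT OF THE WITNESS against any ceiling `e⋆ ≤ E`: `e⋆ − rootEnergy − net ≤ E + 7/5 − 24·a`. [new: negative] -/
theorem transportedDeficit_cluster_le {a : ℝ} (ha : 0 ≤ a) {E : ℝ} (hE : eStar ≤ E) :
    eStar - rootEnergy lennardJones clusterMeasure - net 0 (compPull (4 / 5) (11 / 10) a) clusterMeasure ≤ E + 7 / 5 - 24 * a := by
  linarith [net_cluster_ge ha, rootEnergy_cluster_ge]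

/-- ★★ **NON-TRANSFER.**  For every pull weight `a ≥ 3/100` the witness's transported deficit is `≤ 0` (tree ceiling `e⋆ ≤ −0.7175`): the configuration
that floors every SITEWISE cap at `0.613` is INVISIBLE to the transported cap slot `hcapT` of (404′). [new: negative] -/
theorem transportedDeficit_cluster_nonpos {a : ℝ} (ha : 3 / 100 ≤ a) :
    eStar - rootEnergy lennardJones clusterMeasure - net 0 (compPull (4 / 5) (11 / 10) a) clusterMeasure ≤ 0 := by
  have h := transportedDeficit_cluster_le (by linarith) eStar_le
  linarith

/-- The same from the periodised dimer alone (`e⋆ ≤ −1/24`, in (404)'s own cone), for `a ≥ 3/50`. [new: negative] -/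
theorem transportedDeficit_cluster_nonpos_dimer {a : ℝ} (ha : 3 / 50 ≤ a) :
    eStar - rootEnergy lennardJones clusterMeasure - net 0 (compPull (4 / 5) (11 / 10) a) clusterMeasure ≤ 0 := by
  have h := transportedDeficit_cluster_le (by linarith) eStar_le_neg
  linarith

/-- ★★ THE (410) ARGUMENT YIELDS NOTHING TRANSPORTED: the witness satisfies EVERY transported cap `D ≥ 0` — `hcapT _ isRootedHardCore_cluster` is no
constraint (contrast (410) `floor_add_le_cap`: the same line forces `D ≥ L + 1.3995` sitewise). [new: negative] -/
theorem witness_capT {a D : ℝ} (ha : 3 / 100 ≤ a) (hD : 0 ≤ D) :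
    eStar - rootEnergy lennardJones clusterMeasure - net 0 (compPull (4 / 5) (11 / 10) a) clusterMeasure ≤ D :=
  (transportedDeficit_cluster_nonpos ha).trans hD

/-- ★ (410) N2 DOES NOT TRANSFER VERBATIM: «the cap inequality at the witness forces `3/5 ≤ D`» — true sitewise ((411) `not_cap_three_fifths`) — is
FALSE for the transported cap (take `D = 0`). [new: negative] -/
theorem not_capFloor_transfer {a : ℝ} (ha : 3 / 100 ≤ a) :
    ¬ ∀ D : ℝ, eStar - rootEnergy lennardJones clusterMeasure - net 0 (compPull (4 / 5) (11 / 10) a) clusterMeasure ≤ D → 3 / 5 ≤ D := fun h => by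
  have h0 := h 0 (transportedDeficit_cluster_nonpos ha)
  norm_num at h0

/-- For the record, the two readings of the SAME witness side by side: sitewise deficit `≥ L + 1.3995` for every floor `L ≤ e⋆` ((410)), transported
deficit `≤ 0` ((404′) + this file) — the gap between the dials at this configuration is the booked income `≥ 24a`. [new: negative] -/
theorem sitewise_vs_transported {a L : ℝ} (ha : 3 / 100 ≤ a) (hL : L ≤ eStar) :
    L + 2799 / 2000 ≤ eStar - rootEnergy lennardJones clusterMeasure ∧
      eStar - rootEnergy lennardJones clusterMeasure - net 0 (compPull (4 / 5) (11 / 10) a) clusterMeasure ≤ 0 :=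
  ⟨by linarith [rootEnergy_cluster_le], transportedDeficit_cluster_nonpos ha⟩

/-! ## §5. Fence: the transported slot is inhabited for the compression pull (no numeric `D_T` is claimed) -/

/-- What a root PAYS under the compression pull (its in-flow) is uniformly bounded on rooted `7/10`-hard-core configurations — the route-own finite-range
counting bound `…TransportPriceLocal.exists_outflow_bound_of_finiteRange`, applied to `y ↦ compPull r₁ R a (θ_y μ) (−y) ≤ a·1[‖y‖ ≤ R]`. [folklore] -/
theorem exists_inflow_bound_compPull (r₁ R a : ℝ) : ∃ C : ℝ≥0∞, C ≠ ∞ ∧ ∀ μ : Measure E3, IsRootedHardCore (7 / 10) μ →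
    ∫⁻ y, compPull r₁ R a (μ.map fun x => x - y) (-y) ∂μ ≤ C := by
  obtain ⟨C, hC, hCb⟩ := exists_outflow_bound_of_finiteRange (by norm_num : (0 : ℝ) < 7 / 10) R (ENNReal.ofReal_ne_top (r := a))
  exact ⟨C, hC, fun μ hμ => hCb μ hμ _ (fun y => pullKernel_le _ _) fun y hy => pullKernel_eq_zero_of_lt_norm (by rwa [norm_neg])⟩

/-- ★ FENCE: the transported cap slot `hcapT` of (404′) is INHABITED for the compression pull — some finite `D ≥ 0` works (`D_univ` of (404) plus the
in-flow bound); this file claims NO numeric value (that is K2).  Together with §4: the slot is consistent and the (410) witness does not floor it. [new: bookkeeping] -/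
theorem exists_capT_compPull (r₁ R a : ℝ) : ∃ D : ℝ, 0 ≤ D ∧ ∀ μ : Measure E3, IsRootedHardCore (7 / 10) μ →
    eStar - rootEnergy lennardJones μ - net 0 (compPull r₁ R a) μ ≤ D := by
  obtain ⟨C, hC, hCb⟩ := exists_inflow_bound_compPull r₁ R a
  refine ⟨Duniv + C.toReal, add_nonneg Duniv_nonneg ENNReal.toReal_nonneg, fun μ hμ => ?_⟩
  have hd := deficit_le_Duniv μ hμ
  have hC0 : 0 ≤ C.toReal := ENNReal.toReal_nonneg
  by_cases h0 : Uncompressed r₁ μ 0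
  · have h1 : 0 ≤ net 0 (compPull r₁ R a) μ := net_zero_pullKernel_nonneg_of_mark (uncompressed_hshift r₁) h0
    linarith
  · have h1 : net 0 (compPull r₁ R a) μ = -(∫⁻ y, compPull r₁ R a (μ.map fun x => x - y) (-y) ∂μ).toReal := net_zero_pullKernel_of_not_mark h0
    have h2 := ENNReal.toReal_mono hC (hCb μ hμ)
    linarith

end Summit.AtomisticToContinuum.Crystallization.Theorems.AperiodicFrustratedLawGap.Negative.OffAtlasCapCeilingTransport
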